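import Summits.Ventures.HodgeRepro2.T5SU11SoninPolyaGroup
import Summits.Ventures.HodgeRepro2.T5SU11ResolventBoundary

/-!
# The Sonin–Pólya energy for every solution of the radial equation, and the decaying solution: `|χ_λ′| ≥ √(λ(λ−2)) χ_λ`

Row 486's computation only used the radial equation, so it holds for EVERY `C²` solution `u` of
`sinh 2t · u″ + 2 cosh 2t · u′ = μ sinh 2t · u` on `(0, ∞)`, `μ ≠ 0`:

  **`E_u = u² − u′²/μ` has `E_u′ = 4 cosh 2t · u′²/(μ sinh 2t)`** (`hasDerivAt_energy`), so `E_u` is antitone on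
  `(0, ∞)` for `μ < 0` (`energy_antitoneOn`) and monotone for `μ > 0` (`energy_monotoneOn`).

For the decaying solution `χ_λ` (row 448) with `λ > 2` (`μ = λ(λ−2) > 0`): `χ_λ → 0` (`tendsto_sphDecay_atTop`) and
`χ_λ′ = φ_λ′ T_λ − 1/(sinh 2t φ_λ) → 0` (`tendsto_sphDecay'_atTop`: `|φ_λ′| ≤ √μ φ_λ` by row 486, `φ_λ T_λ = χ_λ → 0`,
`φ_λ ≥ 1`), hence `E_{χ_λ} → 0` (`tendsto_energy_sphDecay_atTop`); being monotone, **`E_{χ_λ} ≤ 0` on `(0, ∞)`**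
(`energy_sphDecay_nonpos`), i.e.

  **`λ(λ−2) χ_λ(t)² ≤ χ_λ′(t)²`, `√(λ(λ−2)) χ_λ(t) ≤ |χ_λ′(t)|`** for every `t > 0` (`sphDecay'_sq_ge`,
  `sqrt_mul_sphDecay_le_abs_sphDecay'`)

— the logarithmic derivative of the decaying solution is at least `√(λ(λ−2))` in absolute value at EVERY `t > 0`
(its limit is `λ`: row 450), the mirror image of row 486's `|φ_λ′/φ_λ| ≤ √(λ(λ−2))` for the regular solution. On the
oscillatory window `1 < λ < 2` the energy `χ_λ² + χ_λ′²/(λ(2−λ))` is antitone on `(0, ∞)` (`energy_sphDecay_antitoneOn`).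

Nothing is claimed about (N).

Blind lane: Mathlib + the HodgeRepro2 prefix only; no sorry; axioms ⊆ {propext, Classical.choice,
Quot.sound}.
-/

namespace Summit.Ventures.HodgeRepro2.T5SU11SoninPolyaDecay

open Filter Topology
open Set (Ioi Ici)
open T5SU11Cartan T5SU11SphericalFunction T5SU11SphericalBounds T5SU11SphericalSolutionSpaceAll
  T5SU11ReductionOfOrder T5SU11ReductionOfOrderInfinity T5SU11SphericalDecay T5SU11SphericalDecayAsymptotic
  T5SU11ResolventBoundary T5SU11SoninPolyaGroup

/-! ### The energy of an arbitrary solution -/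

section general

variable {μ : ℝ} {u u' u'' : ℝ → ℝ} (hu : ∀ t, 0 < t → HasDerivAt u (u' t) t)
  (hu' : ∀ t, 0 < t → HasDerivAt u' (u'' t) t)
  (hode : ∀ t, 0 < t → Real.sinh (2 * t) * u'' t + 2 * Real.cosh (2 * t) * u' t = μ * Real.sinh (2 * t) * u t)

include hu hu' hode in
/-- **`E_u′ = 4 cosh 2t · u′²/(μ sinh 2t)`** for every solution `u` of the radial equation at `μ ≠ 0`. -/
theorem hasDerivAt_energy (hμ : μ ≠ 0) {t : ℝ} (ht : 0 < t) :
    HasDerivAt (fun t => u t ^ 2 - u' t ^ 2 / μ)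
      (4 * Real.cosh (2 * t) * u' t ^ 2 / (μ * Real.sinh (2 * t))) t := by
  have hs : Real.sinh (2 * t) ≠ 0 := (sinh_two_mul_pos ht).ne'
  have h := ((hu t ht).pow 2).sub (((hu' t ht).pow 2).div_const μ)
  refine h.congr_deriv ?_
  have e := hode t ht
  have hq : u'' t = (μ * Real.sinh (2 * t) * u t - 2 * Real.cosh (2 * t) * u' t) / Real.sinh (2 * t) := by
    rw [eq_div_iff hs]
    linear_combination e
  simp only [Nat.cast_ofNat, Nat.add_one_sub_one, pow_one]
  rw [hq]
  field_simp
  ring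

include hu hu' hode in
/-- **The energy is antitone on `(0, ∞)` for `μ < 0`.** -/
theorem energy_antitoneOn (hμ : μ < 0) : AntitoneOn (fun t => u t ^ 2 - u' t ^ 2 / μ) (Ioi 0) := by
  refine antitoneOn_of_deriv_nonpos (convex_Ioi 0)
    (fun t ht => (hasDerivAt_energy hu hu' hode hμ.ne ht).continuousAt.continuousWithinAt) ?_ ?_
  · rw [interior_Ioi]
    exact fun t ht => (hasDerivAt_energy hu hu' hode hμ.ne ht).differentiableAt.differentiableWithinAt
  · rw [interior_Ioi]
    intro t ht
    rw [(hasDerivAt_energy hu hu' hode hμ.ne ht).deriv]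
    refine div_nonpos_iff.mpr (Or.inl ⟨?_, ?_⟩)
    · exact mul_nonneg (mul_nonneg (by norm_num) (Real.cosh_pos _).le) (sq_nonneg _)
    · exact (mul_neg_of_neg_of_pos hμ (sinh_two_mul_pos ht)).le

include hu hu' hode in
/-- **The energy is monotone on `(0, ∞)` for `μ > 0`.** -/
theorem energy_monotoneOn (hμ : 0 < μ) : MonotoneOn (fun t => u t ^ 2 - u' t ^ 2 / μ) (Ioi 0) := by
  refine monotoneOn_of_deriv_nonneg (convex_Ioi 0)
    (fun t ht => (hasDerivAt_energy hu hu' hode hμ.ne' ht).continuousAt.continuousWithinAt) ?_ ?_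
  · rw [interior_Ioi]
    exact fun t ht => (hasDerivAt_energy hu hu' hode hμ.ne' ht).differentiableAt.differentiableWithinAt
  · rw [interior_Ioi]
    intro t ht
    rw [(hasDerivAt_energy hu hu' hode hμ.ne' ht).deriv]
    refine div_nonneg ?_ ?_
    · exact mul_nonneg (mul_nonneg (by norm_num) (Real.cosh_pos _).le) (sq_nonneg _)
    · exact (mul_pos hμ (sinh_two_mul_pos ht)).le

end general

/-! ### The decaying solution -/

section measure

variable [MeasurableSpace Circle] [BorelSpace Circle]

/-- `χ_λ → 0` at infinity for `λ > 1`. -/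
theorem tendsto_sphDecay_atTop {lam : ℝ} (hlam : 1 < lam) : Tendsto (sphDecay lam) atTop (𝓝 0) := by
  have hE : Tendsto (fun t => Real.exp (-(lam * t))) atTop (𝓝 0) :=
    Real.tendsto_exp_neg_atTop_nhds_zero.comp (tendsto_id.const_mul_atTop (by linarith))
  have h := (tendsto_exp_mul_sphDecay hlam).mul hE
  rw [mul_zero] at h
  refine h.congr' (Eventually.of_forall fun t => ?_)
  show Real.exp (lam * t) * sphDecay lam t * Real.exp (-(lam * t)) = sphDecay lam t
  rw [mul_comm, ← mul_assoc, ← Real.exp_add, neg_add_cancel, Real.exp_zero, one_mul]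

/-- `χ_λ′ → 0` at infinity for `λ > 2`. -/
theorem tendsto_sphDecay'_atTop {lam : ℝ} (hlam : 2 < lam) : Tendsto (sphDecay' lam) atTop (𝓝 0) := by
  have hlam1 : 1 < lam := by linarith
  have hμ : 0 < lam * (lam - 2) := mul_pos (by linarith) (by linarith)
  -- the piece `φ_λ′ T_λ`
  have h1 : Tendsto (fun t => deriv (fun t => sph lam (hyp t)) t * tailIntegral (fun t => sph lam (hyp t)) t)
      atTop (𝓝 0) := by
    have hχ := (tendsto_sphDecay_atTop hlam1).const_mul (Real.sqrt (lam * (lam - 2)))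
    rw [mul_zero] at hχ
    refine squeeze_zero_norm' ?_ hχ
    filter_upwards [eventually_gt_atTop 0] with t ht
    have hT : 0 < tailIntegral (fun t => sph lam (hyp t)) t :=
      tailIntegral_pos (hφ_sph lam) (hpos_sph lam) (integrableOn_roIntegrand_sph hlam1) ht
    have hφ : 0 < sph lam (hyp t) := sph_hyp_pos lam t
    have hd : |deriv (fun t => sph lam (hyp t)) t| ≤ Real.sqrt (lam * (lam - 2)) * sph lam (hyp t) := by
      rw [← Real.sqrt_sq_eq_abs, ← Real.sqrt_sq hφ.le, ← Real.sqrt_mul hμ.le]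
      exact Real.sqrt_le_sqrt (deriv_sq_le_mu_mul_sq hμ ht.le)
    rw [Real.norm_eq_abs, abs_mul, abs_of_pos hT]
    calc |deriv (fun t => sph lam (hyp t)) t| * tailIntegral (fun t => sph lam (hyp t)) t
        ≤ Real.sqrt (lam * (lam - 2)) * sph lam (hyp t) * tailIntegral (fun t => sph lam (hyp t)) t :=
          mul_le_mul_of_nonneg_right hd hT.le
      _ = Real.sqrt (lam * (lam - 2)) * sphDecay lam t := by
          unfold sphDecay decaySolution
          ring
  -- the piece `1/(sinh 2t φ_λ)`
  have h2 : Tendsto (fun t => (Real.sinh (2 * t) * sph lam (hyp t))⁻¹) atTop (𝓝 0) := by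
    have hs : Tendsto (fun t => 4 * Real.exp (-(2 * t))) atTop (𝓝 0) := by
      have := (Real.tendsto_exp_neg_atTop_nhds_zero.comp (tendsto_id.const_mul_atTop two_pos)).const_mul 4
      simpa only [mul_zero, Function.comp_def, id] using this
    refine squeeze_zero_norm' ?_ hs
    filter_upwards [eventually_ge_atTop (1 / 2 : ℝ)] with t ht
    have ht0 : 0 < t := by linarith
    have hsp : 0 < Real.sinh (2 * t) := sinh_two_mul_pos ht0
    have hφ1 : 1 ≤ sph lam (hyp t) := one_le_sph_hyp_of_two_le hlam.le t
    have hsinh : Real.exp (2 * t) / 4 ≤ Real.sinh (2 * t) := exp_div_four_le_sinh (by linarith)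
    rw [Real.norm_eq_abs, abs_of_pos (inv_pos.mpr (mul_pos hsp (by linarith)))]
    calc (Real.sinh (2 * t) * sph lam (hyp t))⁻¹ ≤ (Real.sinh (2 * t))⁻¹ :=
          inv_anti₀ hsp (le_mul_of_one_le_right hsp.le hφ1)
      _ ≤ (Real.exp (2 * t) / 4)⁻¹ := inv_anti₀ (by positivity) hsinh
      _ = 4 * Real.exp (-(2 * t)) := by rw [Real.exp_neg, inv_div]; ring
  have h := h1.sub h2
  rw [sub_zero] at h
  refine h.congr' ?_
  filter_upwards [eventually_gt_atTop 0] with t ht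
  exact (sphDecay'_eq hlam1 ht).symm

/-- **`E_{χ_λ} → 0`** at infinity for `λ > 2`. -/
theorem tendsto_energy_sphDecay_atTop {lam : ℝ} (hlam : 2 < lam) :
    Tendsto (fun t => sphDecay lam t ^ 2 - sphDecay' lam t ^ 2 / (lam * (lam - 2))) atTop (𝓝 0) := by
  have h := ((tendsto_sphDecay_atTop (by linarith)).pow 2).sub
    (((tendsto_sphDecay'_atTop hlam).pow 2).div_const (lam * (lam - 2)))
  simpa only [zero_pow two_ne_zero, zero_div, sub_zero] using h

/-- **The energy of the decaying solution is monotone on `(0, ∞)`** for `λ > 2`. -/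
theorem energy_sphDecay_monotoneOn {lam : ℝ} (hlam : 2 < lam) :
    MonotoneOn (fun t => sphDecay lam t ^ 2 - sphDecay' lam t ^ 2 / (lam * (lam - 2))) (Ioi 0) :=
  energy_monotoneOn (fun _ ht => hasDerivAt_sphDecay (by linarith) ht) (fun _ ht => hasDerivAt_sphDecay' lam ht)
    (fun _ ht => sphDecay_ode (by linarith) ht) (mul_pos (by linarith) (by linarith))

/-- **`E_{χ_λ} ≤ 0` on `(0, ∞)`** for `λ > 2`: monotone with limit `0`. -/
theorem energy_sphDecay_nonpos {lam : ℝ} (hlam : 2 < lam) {t : ℝ} (ht : 0 < t) :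
    sphDecay lam t ^ 2 - sphDecay' lam t ^ 2 / (lam * (lam - 2)) ≤ 0 := by
  refine ge_of_tendsto (tendsto_energy_sphDecay_atTop hlam) ?_
  filter_upwards [eventually_ge_atTop t] with s hs
  exact energy_sphDecay_monotoneOn hlam ht (lt_of_lt_of_le ht hs) hs

/-- **`λ(λ−2) χ_λ(t)² ≤ χ_λ′(t)²`** for every `t > 0`, `λ > 2`. -/
theorem sphDecay'_sq_ge {lam : ℝ} (hlam : 2 < lam) {t : ℝ} (ht : 0 < t) :
    lam * (lam - 2) * sphDecay lam t ^ 2 ≤ sphDecay' lam t ^ 2 := by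
  have hμ : 0 < lam * (lam - 2) := mul_pos (by linarith) (by linarith)
  have h := energy_sphDecay_nonpos hlam ht
  have h' : sphDecay lam t ^ 2 ≤ sphDecay' lam t ^ 2 / (lam * (lam - 2)) := by linarith
  rwa [le_div_iff₀ hμ, mul_comm] at h'

/-- **`√(λ(λ−2)) χ_λ(t) ≤ |χ_λ′(t)|`** for every `t > 0`, `λ > 2`: the logarithmic derivative of the decaying
solution is at least `√(λ(λ−2))` in absolute value. -/
theorem sqrt_mul_sphDecay_le_abs_sphDecay' {lam : ℝ} (hlam : 2 < lam) {t : ℝ} (ht : 0 < t) :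
    Real.sqrt (lam * (lam - 2)) * sphDecay lam t ≤ |sphDecay' lam t| := by
  have hμ : 0 ≤ lam * (lam - 2) := (mul_pos (by linarith) (by linarith)).le
  have hχ : 0 < sphDecay lam t := sphDecay_pos (by linarith) ht
  rw [← Real.sqrt_sq_eq_abs, ← Real.sqrt_sq hχ.le, ← Real.sqrt_mul hμ]
  exact Real.sqrt_le_sqrt (sphDecay'_sq_ge hlam ht)

/-- **The energy of the decaying solution is antitone on `(0, ∞)`** on the oscillatory window `1 < λ < 2`. -/
theorem energy_sphDecay_antitoneOn {lam : ℝ} (h1 : 1 < lam) (h2 : lam < 2) :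
    AntitoneOn (fun t => sphDecay lam t ^ 2 - sphDecay' lam t ^ 2 / (lam * (lam - 2))) (Ioi 0) :=
  energy_antitoneOn (fun _ ht => hasDerivAt_sphDecay h1 ht) (fun _ ht => hasDerivAt_sphDecay' lam ht)
    (fun _ ht => sphDecay_ode h1 ht) (mul_neg_of_pos_of_neg (by linarith) (by linarith))

end measure

end Summit.Ventures.HodgeRepro2.T5SU11SoninPolyaDecay
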